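import Summits.NavierStokesRegularity.NavierStokesRegularity.Theorems.FilamentSkeletonRssDefectColumnGateDefsL
import Summits.NavierStokesRegularity.NavierStokesRegularity.Theorems.FilamentSkeletonRssDefectColumnGateClosingIVTL
import Summits.NavierStokesRegularity.NavierStokesRegularity.Theorems.FilamentSkeletonRssDefectColumnGateContinuity
import HarnessLib.Audit

/-!
# Line `defect_column_gate_1AL` for the crux `FilamentSkeletonRss.TransverseReduction1AL` (stmt-NavierStokesRegularity-23297) — skeleton v5

**LEAD EDIT (ns-filament-21221-p1 g11, LEAD of 23297 = the L-twin of the aside 27853, 2026-08-28) — skeleton v5 = the A1L RE-POINTING of v4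
(ceb3508ea1397354) asked by tenure g23 (d).**  Variant A1L (rigid matched cores; route revs 44–47, director-ns dss_108 (A)) swaps ONE conjunct of the
clause block (`Clauses1G` → `Clauses1L`: passive core-area law → `1 ≤ KA·Aa j (c j) ∧ (‖X j τ‖ ≤ 2Rb√(Γ log Γ) → Aa j τ = Aa j (c j))`); the line is unchanged
in substance: S0 `stub_rateSelection1AL : RateSelection1AL` (KILL-FIRST #1; MODEL job PREREG 92d939c9602b1b49 keyed dss_108 (D)), S1 `stub_familyDressing1AL`
(now with the ns-idea-12 `la-rigid-core` dressing instruction — LA-consistent constant-area cores are exactly what A1L legislates), S2a-loc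
`stub_waistColumnGateLoc1A : WaistColumnGateLoc1A` (clause-free, SAME NAME AND TEXT as on 27853 — the s2aloc seat's V1 scan of 20:24Z found NO HIT; the
lead's memo S2A-LOC-ANALYSIS-27853-g11.md: ALIVE on paper, m = 0 sector PROVED with no loss p663731, displacement level γ/2 kernel-checked p664587),
S2b-loc `stub_gateAssemblyLoc1AL : GateAssemblyLoc1AL`; S3 is a THEOREM (S3a `stub_closingIVT1AL` ported, S3b `DefectContinuity1AG` clause-free, p646054).
Vocabulary: `Theorems/FilamentSkeletonRssDefectColumnGateDefsL.lean` (the L re-pointing) over `…Defs.lean`.  Composition `TransverseReduction1AL_of` concludes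
the crux BY NAME from the four `stub_*`.  The v4 text (strategist cstrat-21221 g3 + lead edits g9/g10) applies verbatim with G → L; see
`Lines/defect_column_gate_1AG.lean` for the O1/T/G design notes and `Lines/defect_column_gate_1AG_briefs.md` (v5) for the stub briefs.

HONEST FRAMING.  Bookkeeping for a HYPOTHETICAL filament-type rotating-self-similar blow-up route (`route-NavierStokesRegularity-FilamentSkeletonRss`,
refutation side: `closes … : ¬ NavierStokesRegularity`).  Nothing in this file moves Navier–Stokes regularity.  MODEL rung, negative side.
`lean check`: rc 0, sorries = 4 (only `stub_*`).
-/

set_option linter.dupNamespace false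

noncomputable section

namespace Summit.NavierStokesRegularity.NavierStokesRegularity.Cruxes.TransverseReduction1AL.DefectColumnGate

open scoped BigOperators Topology Manifold Classical MeasureTheory ProbabilityTheory Matrix InnerProductSpace ComplexConjugate ContinuousMap ENNReal ContDiff
open Filter Set Function TopologicalSpace MeasureTheory
open Literature.NS
open Literature.Analysis.FluidPDE
open Summit.NavierStokesRegularity.NavierStokesRegularity.Theses.FilamentSkeletonRss
open Summit.NavierStokesRegularity.NavierStokesRegularity.Theorems.KelvinGate (lerayOp lerayLin XBound YBound LocClose)
open Summit.NavierStokesRegularity.NavierStokesRegularity.Theorems.DefectColumnGate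

/-! ## 5. Registered stubs and the kernel-checked composition -/

/-- **Stub S0** (`RateSelection1AL`) — KILL-FIRST #1: skeleton-level, one augmented linear map per skeleton; prove it or refute it. -/
theorem stub_rateSelection1AL : RateSelection1AL := by
  sorry

/-- **Stub S1** (`FamilyDressing1AL`) — matched asymptotics with rate corrections, re-wound ends, forced window. -/
theorem stub_familyDressing1AL : FamilyDressing1AL := by
  sorry

/-- **Stub S2a-loc** (`WaistColumnGateLoc1A`) — KILL-FIRST #2: one explicit linear operator, SECTIONALLY LOCALISED (radius `R`, loss
`C·Rc^q·R^q`); replaces `WaistColumnGate1A`, which is false as typed (lead g10, evidence #25). -/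
theorem stub_waistColumnGateLoc1A : WaistColumnGateLoc1A := by
  sorry

/-- **Stub S2b-loc** (`GateAssemblyLoc1AL`) — patching: rate selection + LOCALISED sectional gate ⟹ defect-bordered gate. -/
theorem stub_gateAssemblyLoc1AL : GateAssemblyLoc1AL := by
  sorry

/-- **Stub S3a** (`ClosingIVT1AL`) — PROVED for the L-twin by the lead (Theorems/FilamentSkeletonRssDefectColumnGateClosingIVTL.lean; port of p646026):
frozen-rate contraction + IVT on the scalar defect, given the continuity S3b. -/
theorem stub_closingIVT1AL : ClosingIVT1AL :=
  Summit.NavierStokesRegularity.NavierStokesRegularity.Theorems.DefectColumnGate.stub_closingIVT1AL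

/-- **Stub S3b** (`DefectContinuity1AG`) — PROVED by the lead (Theorems/FilamentSkeletonRssDefectColumnGateContinuity.lean, p646054):
continuity of `β ↦ 𝓫_β G_β` on the closed window (Picard truncation + finite regress of balls). -/
theorem stub_defectContinuity1AG : DefectContinuity1AG :=
  Summit.NavierStokesRegularity.NavierStokesRegularity.Theorems.DefectColumnGate.stub_defectContinuity1AG

/-- **S3 `DefectClosing1AL` — a THEOREM** (both halves proved by the lead; no sorry in its cone). -/
theorem defectClosing1AL_of_stubs : DefectClosing1AL :=
  stub_closingIVT1AL stub_defectContinuity1AG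

/-- **Glue (pure logic + the LANDED smoothing ladder, no sorry).** -/
theorem lineGlue1AL (h1 : DefectFamily1AL) (h2 : DefectGate1AL) (h3 : DefectClosing1AL) : CutForm1AL := by
  intro N δ ρ K Λ a b cnd η Rw Rb cg θ₀ KA hN hδ hρ ha hη hRw hRb hcg hθ₀
  obtain ⟨Cs, hS1⟩ := h1 N δ ρ K Λ a b cnd η Rw Rb cg θ₀ KA hN hδ hρ ha hη hRw hRb hcg hθ₀
  obtain ⟨κ, C₂, q₀, k₀, hS2⟩ := h2 N δ ρ K Λ a b cnd η Rw Rb cg θ₀ KA hN hδ hρ ha hη hRw hRb hcg hθ₀ Cs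
  obtain ⟨q₁, hq, k, hk₀, hk, hS3⟩ := h3 N δ ρ K Λ a b cnd η Rw Rb cg θ₀ KA hN hδ hρ ha hη hRw hRb hcg hθ₀ Cs κ C₂ q₀ k₀
  obtain ⟨Cr, Γa, hS1'⟩ := hS1 q₁ k
  obtain ⟨Γb, hS2'⟩ := hS2 q₁ hq k hk₀ hk Cr
  obtain ⟨Γc, hS3'⟩ := hS3 Cr
  refine ⟨max Γa (max Γb Γc), ?_⟩
  intro Γ hΓ γ α X w c m n Aa u v A T hu hv hA hT hcl
  have hΓa : Γa ≤ Γ := le_trans (le_max_left _ _) hΓ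
  have hΓb : Γb ≤ Γ := le_trans (le_trans (le_max_left _ _) (le_max_right _ _)) hΓ
  have hΓc : Γc ≤ Γ := le_trans (le_trans (le_max_right _ _) (le_max_right _ _)) hΓ
  obtain ⟨α0, β₀, U0, P0, Z, g, r, hfam⟩ := hS1' Γ hΓa γ α X w c m n Aa u v A T hu hv hA hT hcl
  obtain ⟨𝓚, 𝓠, 𝓫, hgate⟩ := hS2' Γ hΓb γ α X w c m n Aa u v A T hu hv hA hT hcl α0 β₀ U0 P0 Z g r hfam
  obtain ⟨α₁, C₀, M, U, P, hU⟩ := hS3' Γ hΓc γ α X w c m n Aa u v A T hu hv hA hT hcl α0 β₀ U0 P0 Z g r hfam 𝓚 𝓠 𝓫 hgate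
  obtain ⟨hα₁, hne, hU2, hP1, hdiv, heq, hdec, hPM, hwin⟩ := hU
  have hF : ContDiff ℝ ∞ (fun _ : EuclideanSpace ℝ (Fin 3) => (0 : EuclideanSpace ℝ (Fin 3))) := contDiff_const
  have hUs : ContDiff ℝ ∞ U :=
    Theorems.KelvinGate.Smoothing.contDiff_velocity_infty (F := fun _ => 0) hU2 hdiv hP1 hF heq
  have hPs : ContDiff ℝ ∞ P :=
    Theorems.KelvinGate.Smoothing.contDiff_pressure_infty (F := fun _ => 0) hU2 hdiv hP1 hF heq
  exact ⟨α₁, C₀, M, U, P, hα₁, hne, hUs, hPs, hdiv, heq, hdec, hPM, hwin⟩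

/-- **The skeleton (A12 shape): the crux BY NAME from the registered stubs** — S1's conclusion is
`stub_familyDressing1AL stub_rateSelection1AL`, S2b-loc's is `stub_gateAssemblyLoc1AL stub_rateSelection1AL stub_waistColumnGateLoc1A`, S3 is
`stub_closingIVT1AL stub_defectContinuity1AG` (lead reshapes g9 / g10). -/
theorem TransverseReduction1AL_of : TransverseReduction1AL :=
  transverseReduction1AL_iff.mpr
    (lineGlue1AL (stub_familyDressing1AL stub_rateSelection1AL)
      (stub_gateAssemblyLoc1AL stub_rateSelection1AL stub_waistColumnGateLoc1A) defectClosing1AL_of_stubs)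


end Summit.NavierStokesRegularity.NavierStokesRegularity.Cruxes.TransverseReduction1AL.DefectColumnGate

end
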